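import Summits.NavierStokesRegularity.FluidComputer.PalasekTowerClayBridge

/-!
# The minimal E-C witness: what Fefferman's (C) needs from ANY forced blow-up construction

Cell `ns-blowup`, seat `ns-blowup-ecbridge-1`; companion of `PalasekTowerClayBridge.lean` (LABEL: E-C;
WHAT THIS IS NOT: not Navier–Stokes evidence, not a construction — a type and a conditional
implication). `Realisation ν R` packages a Palasek tower WITH its rates; the bridge to (C) consumes
only a rate-free core. This file isolates that core as `BreakdownWitness ν` — an exact classical
solution of the forced system on `[0, T) × ℝ³` from a Clay datum with a Clay-class force (smooth
through `T`), finite energy on closed slabs before `T`, and LOCAL UNBOUNDEDNESS of the velocity in a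
fixed ball as `t ↑ T` — so that every lane of the cell (N1* tower, FC cascade, any future object)
targets the same typed endpoint: `navierStokesBreakdownR3_of_witnesses : (forced Cor. 11.4) →
(∀ ν > 0, Nonempty (BreakdownWitness ν)) → NavierStokesBreakdownR3`, and
`Realisation.toWitness : Realisation ν R → BreakdownWitness ν`. Local unboundedness (rather than
maximality of the lifespan) is the right clause: it is what a construction exhibits, it implies
maximality (`BreakdownWitness.not_hasSmoothExtensionPast`), and it is what contradicts the continuity
of a global smooth solution on the compact `[0, T] × B̄(0, r)` once uniqueness identifies the two.

References: C. L. Fefferman, Clay problem description, (C) (4)–(7) [cite: FeffermanClay2006, (C)];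
T. Tao, Anal. PDE 6 (2013), Cor. 11.4 [cite: Tao2011, Cor. 11.4]; J. T. Beale, T. Kato, A. Majda,
Comm. Math. Phys. 94 (1984) §1 [cite: BealeKatoMajda1984, §1].
-/

noncomputable section

namespace Summit.NavierStokesRegularity.FluidComputer.PalasekTowerClayBridge

open Set MeasureTheory Filter Topology Function
open scoped ENNReal ContDiff NNReal
open Literature.Analysis.FluidPDE
open Summit.NavierStokesRegularity.NavierStokesRegularity

/-- **The minimal E-C witness at viscosity `ν`.** An exact classical solution `(u, p)` of the forced
Navier–Stokes system on `[0, T) × ℝ³` whose datum `u 0` is a Clay datum (4), whose force is smooth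
on the closed half-space `[0, ∞) × ℝ³` with Fefferman's decay (5) — in particular smooth THROUGH
`T` —, with finite energy on every closed slab `[0, T']`, `T' < T`, and whose velocity is unbounded
on `[0, T) × B̄(0, radius)` for some fixed radius. A TYPE; no instance is claimed.
[cite: FeffermanClay2006, (C) (4) (5) (6)] -/
structure BreakdownWitness (ν : ℝ) where
  /-- the blow-up time -/
  T : ℝ
  T_pos : 0 < T
  /-- velocity, pressure, force -/
  u : ℝ → EuclideanSpace ℝ (Fin 3) → EuclideanSpace ℝ (Fin 3)
  p : ℝ → EuclideanSpace ℝ (Fin 3) → ℝ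
  f : ℝ → EuclideanSpace ℝ (Fin 3) → EuclideanSpace ℝ (Fin 3)
  /-- exact classical forced Navier–Stokes on `[0, T)` -/
  classical : IsClassicalNSSolutionOn (Ico 0 T) ν f u p
  /-- Clay datum (4) -/
  datum_decay : HasRapidSpatialDecay (u 0)
  /-- Clay force (6), through and past `T` -/
  force_smooth : IsSmoothOnHalfSpace f
  /-- Clay force (5) -/
  force_decay : HasRapidSpaceTimeDecay f
  /-- finite energy on closed slabs before `T` -/
  energy : ∀ T', T' < T → ∃ C : ℝ≥0∞, C < ⊤ ∧ ∀ t ∈ Icc 0 T', ∫⁻ x, ‖u t x‖ₑ ^ 2 ≤ C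
  /-- radius of the ball where the velocity blows up -/
  radius : ℝ
  /-- local unboundedness of the velocity before `T` -/
  unbounded : ∀ M : ℝ, ∃ t ∈ Ico 0 T, ∃ x, ‖x‖ ≤ radius ∧ M < ‖u t x‖

namespace BreakdownWitness

variable {ν : ℝ} (W : BreakdownWitness ν)

/-- **Local unboundedness forbids continuity up to `T` on the ball.** A field that agrees with the
witness on `[0, T)` is NOT continuous on the compact box `[0, T] × B̄(0, radius)` (it would be
bounded there). [folklore] -/
theorem not_continuousOn_box
    {v : ℝ → EuclideanSpace ℝ (Fin 3) → EuclideanSpace ℝ (Fin 3)}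
    (heq : ∀ t ∈ Ico 0 W.T, v t = W.u t) :
    ¬ ContinuousOn (uncurry v)
      (Icc (0 : ℝ) W.T ×ˢ Metric.closedBall (0 : EuclideanSpace ℝ (Fin 3)) W.radius) := by
  intro hcont
  have hK : IsCompact (Icc (0 : ℝ) W.T ×ˢ Metric.closedBall (0 : EuclideanSpace ℝ (Fin 3)) W.radius) :=
    isCompact_Icc.prod (isCompact_closedBall _ _)
  obtain ⟨M, hM⟩ := hK.exists_bound_of_continuousOn hcont
  obtain ⟨t, ht, x, hxR, hMx⟩ := W.unbounded M
  have hxK : x ∈ Metric.closedBall (0 : EuclideanSpace ℝ (Fin 3)) W.radius := by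
    rw [Metric.mem_closedBall, dist_zero_right]
    exact hxR
  have hbound := hM _ (mk_mem_prod ⟨ht.1, ht.2.le⟩ hxK)
  have hvt : v t = W.u t := heq t ht
  simp only [Function.uncurry_apply_pair, hvt] at hbound
  linarith

/-- **A witness admits no classical extension past `T`** (Beale–Kato–Majda: `T` is the maximal
time of smooth existence; with `W.classical` this is `IsMaximalSmoothSolution ν W.f W.u W.p W.T`,
obtained as `⟨W.classical, W.not_hasSmoothExtensionPast⟩`) — independently of any uniqueness
theorem: an extension is jointly smooth, hence continuous on the box, contradicting
`not_continuousOn_box`. [cite: BealeKatoMajda1984, §1] -/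
theorem not_hasSmoothExtensionPast : ¬ HasSmoothExtensionPast ν W.f W.u W.T := by
  rintro ⟨T', hT', u', p', hcl', heq⟩
  refine W.not_continuousOn_box heq ?_
  have hsub : Icc (0 : ℝ) W.T ×ˢ Metric.closedBall (0 : EuclideanSpace ℝ (Fin 3)) W.radius ⊆
      Ico (0 : ℝ) T' ×ˢ (univ : Set (EuclideanSpace ℝ (Fin 3))) :=
    prod_mono (fun s hs => ⟨hs.1, lt_of_le_of_lt hs.2 hT'⟩) (subset_univ _)
  exact (ContDiffOn.continuousOn hcl'.smooth_velocity).mono hsub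

/-- Uniqueness against a global Clay-class solution from the same datum and force, given Tao's
Cor. 11.4 with its force slot: equality on `[0, T)`. [cite: Tao2011, Cor. 11.4] -/
theorem eq_of_claySolution (hU : tao_unconditional_uniqueness_velocity_forced) (hν : 0 < ν)
    {v : ℝ → EuclideanSpace ℝ (Fin 3) → EuclideanSpace ℝ (Fin 3)}
    {q : ℝ → EuclideanSpace ℝ (Fin 3) → ℝ}
    (hv : IsSmoothOnHalfSpace v) (hq : IsSmoothOnHalfSpace q)
    (hns : IsNavierStokesSolution ν W.f (W.u 0) v q) (hE : HasBoundedEnergy v) :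
    ∀ t ∈ Ico 0 W.T, v t = W.u t := by
  intro t ht
  obtain ⟨ht0, htT⟩ := ht
  rcases ht0.eq_or_lt with h00 | ht0'
  · subst h00
    exact hns.initial
  · have hclv : IsClassicalNSSolutionOn (Ici 0) ν W.f v q :=
      (isNavierStokesSolution_and_smooth_iff.1 ⟨hns, hv, hq⟩).1
    have hv' : IsClassicalNSSolutionOn (Icc 0 t) ν W.f v q :=
      hclv.mono (fun s hs => hs.1) (uniqueDiffOn_Icc ht0')
    have hu' : IsClassicalNSSolutionOn (Icc 0 t) ν W.f W.u W.p :=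
      W.classical.mono (fun s hs => ⟨hs.1, lt_of_le_of_lt hs.2 htT⟩) (uniqueDiffOn_Icc ht0')
    have hC1 : ContDiff ℝ 1 (W.u 0) :=
      (W.classical.contDiff_velocity (t := 0) ⟨le_rfl, W.T_pos⟩).of_le (by norm_cast)
    obtain ⟨hL2, hH1⟩ := Theorems.ClayUniqueness.memLp_two_of_rapidDecay W.datum_decay hC1
    have hEv : ∃ C : ℝ≥0∞, C < ⊤ ∧ ∀ s ∈ Icc 0 t, ∫⁻ x, ‖v s x‖ₑ ^ 2 ≤ C := by
      obtain ⟨C, hC, hb⟩ := hE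
      exact ⟨C, hC, fun s hs => hb s hs.1⟩
    exact hU ν t hν ht0' (W.u 0) hL2 hH1 W.f W.force_smooth W.force_decay v W.u q W.p hv' hu'
      hns.initial rfl hEv (W.energy t htT) t ⟨ht0, le_rfl⟩

/-- No global Clay-class solution shares the witness's datum and force (given the forced
Cor. 11.4). [cite: FeffermanClay2006, (C)] -/
theorem not_exists_claySolution (hU : tao_unconditional_uniqueness_velocity_forced) (hν : 0 < ν) :
    ¬ ∃ (v : ℝ → EuclideanSpace ℝ (Fin 3) → EuclideanSpace ℝ (Fin 3))
        (q : ℝ → EuclideanSpace ℝ (Fin 3) → ℝ),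
        IsSmoothOnHalfSpace v ∧ IsSmoothOnHalfSpace q ∧
          IsNavierStokesSolution ν W.f (W.u 0) v q ∧ HasBoundedEnergy v := by
  rintro ⟨v, q, hv, hq, hns, hE⟩
  refine W.not_continuousOn_box (W.eq_of_claySolution hU hν hv hq hns hE) ?_
  have hsub : Icc (0 : ℝ) W.T ×ˢ Metric.closedBall (0 : EuclideanSpace ℝ (Fin 3)) W.radius ⊆
      Ici (0 : ℝ) ×ˢ (univ : Set (EuclideanSpace ℝ (Fin 3))) :=
    prod_mono (fun s hs => hs.1) (subset_univ _)
  exact (ContDiffOn.continuousOn hv).mono hsub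

end BreakdownWitness

/-- **The E-C endpoint, rate-free form.** Witnesses at every viscosity, plus Tao's unconditional
uniqueness with its force slot, give Fefferman's (C). [cite: FeffermanClay2006, (C)] [cite: Tao2011, Cor. 11.4] -/
theorem navierStokesBreakdownR3_of_witnesses (hU : tao_unconditional_uniqueness_velocity_forced)
    (h : ∀ ν : ℝ, 0 < ν → Nonempty (BreakdownWitness ν)) :
    Summit.NavierStokesRegularity.NavierStokesRegularity.NavierStokesBreakdownR3 := by
  intro ν hν
  obtain ⟨W⟩ := h ν hν
  exact ⟨W.u 0, W.f, W.classical.contDiff_velocity (t := 0) ⟨le_rfl, W.T_pos⟩,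
    W.classical.divFree 0 ⟨le_rfl, W.T_pos⟩, W.datum_decay, W.force_smooth, W.force_decay,
    W.not_exists_claySolution hU hν⟩

/-- **A realised tower is a witness**: forget the rates, keep the Clay clauses, and read local
unboundedness off the velocity floors `c₁ N_k^{β-1} → ∞` at the points `(τ k, x_k)` of the ball.
[cite: Palasek2026ElementaryModel, §4] -/
def Realisation.toWitness {ν : ℝ} {R : TowerRates} (W : Realisation ν R) : BreakdownWitness ν where
  T := W.T
  T_pos := W.T_pos
  u := W.u
  p := W.p
  f := W.f
  classical := W.classical
  datum_decay := W.datum_decay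
  force_smooth := W.force_smooth
  force_decay := W.force_decay
  energy := W.energy
  radius := W.radius
  unbounded := by
    intro M
    have hc₁ : 0 < W.c₁ := W.c₁_pos
    have hev : ∀ᶠ k in atTop, M / W.c₁ + 1 ≤ R.Y k :=
      R.tendsto_Y_atTop.eventually (eventually_ge_atTop (M / W.c₁ + 1))
    obtain ⟨k, hk⟩ := hev.exists
    obtain ⟨x, hxR, hfloor⟩ := W.floor k
    refine ⟨W.τ k, W.τ_mem k, x, hxR, ?_⟩
    have h3 : M / W.c₁ < R.Y k := by linarith
    have h4 : M < R.Y k * W.c₁ := (div_lt_iff₀ hc₁).1 h3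
    have h5 : M < W.c₁ * R.Y k := by rwa [mul_comm] at h4
    exact lt_of_lt_of_le h5 hfloor

end Summit.NavierStokesRegularity.FluidComputer.PalasekTowerClayBridge

end
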